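import Mathlib
import Summits.AtomisticToContinuum.Crystallization.Theorems.GappedShellCensusFiveFoldRationingRStubFfrC5KillsAux2

/-!
# Crux `GappedShellCensus.FiveFoldRationingR` (stmt-AtomisticToContinuum-18071), line `Sketch` —
# helpers for stub `stub_ffrC5Kills` (angle-budget kills on abstract fan data), part 3

On abstract fan data (see parts 1, 2): a five-valent label with exactly four bond triangles in its
star is an open `4T+Q` star.  `ffrK_star` derives the hypotheses of the walk `stub_ffrC5KillsWalk`
from an "exceptional set" `E` of fan triangles at `v` outside which every fan triangle at `v` is a
bond triangle; `stub_ffrC5KillsFourQ` (registered sub-goal: the exceptional sector is a quad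
corner) and `ffrK_fourH` (the exceptional sector is an `H`-pair through a non-partner `x`) are its
two instances.
-/

noncomputable section

namespace Summit.AtomisticToContinuum.Crystallization.Theorems

open Real

/-- **The open star from an exceptional sector.** Let `v` have five bond partners, among them
`a ≠ z` (not bonded) both bonded to a non-partner `x ≠ v`.  Suppose every fan triangle at `v`
outside an exceptional set `E` is a bond triangle, that `a` (resp. `z`) lies in a fan triangle
`Sa` (resp. `Sz`) containing no partner of `v` bonded to `a` (resp. `z`), that `Sa` is the
only member of `E` through `a`, and that the members of `E` contain no partner of `v` other
than `a, z`.  Then the hypotheses of `ffrK_walk` hold, so the configuration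
is an open `4T+Q` star: impossible (`stub_ffrC5KillsWalk`). [folklore] -/
theorem ffrK_star (bond : Fin 12 → Fin 12 → Bool) (tri : Finset (Finset (Fin 12)))
    (bond_symm : ∀ v w, bond v w = bond w v) (bond_irrefl : ∀ v, bond v v = false)
    (tri_card : ∀ S ∈ tri, S.card = 3)
    (two_per_side : ∀ S ∈ tri, ∀ s ⊆ S, s.card = 2 → (tri.filter fun S' => s ⊆ S').card = 2)
    (bond_side : ∀ v w, bond v w = true →
      (tri.filter fun S' => ({v, w} : Finset (Fin 12)) ⊆ S').card = 2)
    (bond_tri : ∀ a b c, a ≠ b → b ≠ c → a ≠ c → bond a b = true → bond b c = true → bond a c = true →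
      ({a, b, c} : Finset (Fin 12)) ∈ tri)
    (noOpenStar : ∀ v a₁ a₂ a₃ a₄ a₅ x : Fin 12, Function.Injective ![v, a₁, a₂, a₃, a₄, a₅, x] →
      bond v a₁ = true → bond v a₂ = true → bond v a₃ = true → bond v a₄ = true → bond v a₅ = true →
      bond a₁ a₂ = true → bond a₂ a₃ = true → bond a₃ a₄ = true → bond a₄ a₅ = true →
      bond a₅ a₁ = false → bond x a₅ = true → bond x a₁ = true → bond v x = false → False)
    {v a z x : Fin 12} (E : Finset (Finset (Fin 12))) {Sa Sz : Finset (Fin 12)}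
    (hP5 : (Finset.univ.filter fun w => bond v w = true).card = 5)
    (hva : bond v a = true) (hvz : bond v z = true) (haz : a ≠ z) (hazb : bond a z = false)
    (hxa : bond x a = true) (hxz : bond x z = true) (hvx : bond v x = false) (hxv : x ≠ v)
    (hE : ∀ S ∈ tri, v ∈ S → S ∉ E → ∀ p ∈ S, ∀ q ∈ S, p ≠ q → bond p q = true)
    (hSa : Sa ∈ tri) (hvSa : v ∈ Sa) (haSa : a ∈ Sa)
    (hSa' : ∀ s ∈ Sa, bond v s = true → bond a s = true → False) (hEa : ∀ S ∈ E, a ∈ S → S = Sa)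
    (hSz : Sz ∈ tri) (hvSz : v ∈ Sz) (hzSz : z ∈ Sz)
    (hSz' : ∀ s ∈ Sz, bond v s = true → bond z s = true → False)
    (hEp : ∀ S ∈ E, ∀ p ∈ S, bond v p = true → p = a ∨ p = z) : False := by
  have ne_of_bond : ∀ {p q : Fin 12}, bond p q = true → p ≠ q := fun h e => by
    rw [e, bond_irrefl] at h
    exact Bool.false_ne_true h
  -- at most one partner of `v` is bonded to `c ∈ {a, z}`
  have uniq : ∀ (c : Fin 12) (Sc : Finset (Fin 12)), bond v c = true → Sc ∈ tri → v ∈ Sc → c ∈ Sc →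
      (∀ s ∈ Sc, bond v s = true → bond c s = true → False) →
      ∀ s s', bond v s = true → bond v s' = true → bond c s = true → bond c s' = true → s = s' := by
    intro c Sc hvc hSc hvSc hcSc hno s s' hvs hvs' hcs hcs'
    have hvc' : v ≠ c := ne_of_bond hvc
    obtain ⟨Y, -, -, -, -, hall⟩ := ffrK_fib_cases tri two_per_side hSc hvSc hcSc hvc'
    have key : ∀ t, bond v t = true → bond c t = true → ({v, c, t} : Finset (Fin 12)) = Y := by
      intro t hvt hct
      have hT : ({v, c, t} : Finset (Fin 12)) ∈ tri :=
        bond_tri v c t hvc' (ne_of_bond hct) (ne_of_bond hvt) hvc hct hvt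
      rcases hall _ hT (by simp) (by simp) with h | h
      · exact (hno t (by rw [← h]; simp) hvt hct).elim
      · exact h
    have h := key s hvs hcs
    rw [← key s' hvs' hcs'] at h
    have hs : s ∈ ({v, c, s'} : Finset (Fin 12)) := by rw [← h]; simp
    simp only [Finset.mem_insert, Finset.mem_singleton] at hs
    rcases hs with e | e | e
    · exact absurd e (ne_of_bond hvs).symm
    · exact absurd e (ne_of_bond hcs).symm
    · exact e
  -- some partner of `v` is bonded to `a`
  have hexA : ∃ b, bond v b = true ∧ bond a b = true := by
    obtain ⟨Y, hY, hvY, haY, hYne, -⟩ := ffrK_fib_cases tri two_per_side hSa hvSa haSa (ne_of_bond hva)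
    have hYE : Y ∉ E := fun h => hYne (hEa Y h haY)
    have hF := hE Y hY hvY hYE
    obtain ⟨s, hsv, hsa, rfl⟩ := ffrK_third (tri_card Y hY) hvY haY (ne_of_bond hva)
    exact ⟨s, hF v (by simp) s (by simp) hsv.symm, hF a (by simp) s (by simp) hsa.symm⟩
  -- every other partner `p` has exactly two partners of `v` bonded to it
  have hdeg2 : ∀ p, bond v p = true → p ≠ a → p ≠ z → ∃ s₁ s₂, s₁ ≠ s₂ ∧ bond v s₁ = true ∧
      bond v s₂ = true ∧ bond p s₁ = true ∧ bond p s₂ = true ∧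
      ∀ s, bond v s = true → bond p s = true → s = s₁ ∨ s = s₂ := by
    intro p hvp hpa hpz
    have hvp' : v ≠ p := ne_of_bond hvp
    have h2 := ffrK_fib_two_bond bond tri bond_side hvp
    obtain ⟨X₁, X₂, hne, heq⟩ := Finset.card_eq_two.1 h2
    have hX₁ : X₁ ∈ (tri.filter fun S => v ∈ S).filter fun S => p ∈ S := by rw [heq]; simp
    have hX₂ : X₂ ∈ (tri.filter fun S => v ∈ S).filter fun S => p ∈ S := by rw [heq]; simp
    simp only [Finset.mem_filter] at hX₁ hX₂
    have hXE : ∀ X ∈ tri, p ∈ X → X ∉ E := fun X _ hpX hXE => by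
      rcases hEp X hXE p hpX hvp with h | h
      · exact hpa h
      · exact hpz h
    have hF₁ := hE X₁ hX₁.1.1 hX₁.1.2 (hXE X₁ hX₁.1.1 hX₁.2)
    have hF₂ := hE X₂ hX₂.1.1 hX₂.1.2 (hXE X₂ hX₂.1.1 hX₂.2)
    obtain ⟨s₁, hs₁v, hs₁p, rfl⟩ := ffrK_third (tri_card _ hX₁.1.1) hX₁.1.2 hX₁.2 hvp'
    obtain ⟨s₂, hs₂v, hs₂p, rfl⟩ := ffrK_third (tri_card _ hX₂.1.1) hX₂.1.2 hX₂.2 hvp'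
    refine ⟨s₁, s₂, fun e => hne (by rw [e]), hF₁ v (by simp) s₁ (by simp) hs₁v.symm,
      hF₂ v (by simp) s₂ (by simp) hs₂v.symm, hF₁ p (by simp) s₁ (by simp) hs₁p.symm,
      hF₂ p (by simp) s₂ (by simp) hs₂p.symm, fun s hvs hps => ?_⟩
    have hT : ({v, p, s} : Finset (Fin 12)) ∈ tri :=
      bond_tri v p s hvp' (ne_of_bond hps) (ne_of_bond hvs) hvp hps hvs
    have hT' : ({v, p, s} : Finset (Fin 12)) ∈ ({{v, p, s₁}, {v, p, s₂}} : Finset (Finset (Fin 12))) := by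
      rw [← heq]
      simp only [Finset.mem_filter]
      exact ⟨⟨hT, by simp⟩, by simp⟩
    simp only [Finset.mem_insert, Finset.mem_singleton] at hT'
    have aux : ∀ t, t ≠ v → t ≠ p → ({v, p, s} : Finset (Fin 12)) = {v, p, t} → s = t := by
      intro t htv htp h
      have ht : t ∈ ({v, p, s} : Finset (Fin 12)) := by rw [h]; simp
      simp only [Finset.mem_insert, Finset.mem_singleton] at ht
      rcases ht with e | e | e
      · exact absurd e htv
      · exact absurd e htp
      · exact e.symm
    rcases hT' with h | h
    · exact Or.inl (aux s₁ hs₁v hs₁p h)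
    · exact Or.inr (aux s₂ hs₂v hs₂p h)
  exact stub_ffrC5KillsWalk bond bond_symm bond_irrefl noOpenStar v a z x hP5 hva hvz haz hazb hxa hxz
    hvx hxv (uniq a Sa hva hSa hvSa haSa hSa') (uniq z Sz hvz hSz hvSz hzSz hSz') hexA hdeg2

/-- **Registered sub-goal: `4T+Q` at a five-valent label is the open star.** If `v` has five bond partners and every
fan triangle at `v` except one quad corner `Sq` is a bond triangle, then `noOpenStar` is violated.
[folklore] -/
theorem stub_ffrC5KillsFourQ (bond : Fin 12 → Fin 12 → Bool) (tri : Finset (Finset (Fin 12)))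
    (bond_symm : ∀ v w, bond v w = bond w v) (bond_irrefl : ∀ v, bond v v = false)
    (tri_card : ∀ S ∈ tri, S.card = 3)
    (two_per_side : ∀ S ∈ tri, ∀ s ⊆ S, s.card = 2 → (tri.filter fun S' => s ⊆ S').card = 2)
    (bond_side : ∀ v w, bond v w = true →
      (tri.filter fun S' => ({v, w} : Finset (Fin 12)) ⊆ S').card = 2)
    (bond_tri : ∀ a b c, a ≠ b → b ≠ c → a ≠ c → bond a b = true → bond b c = true → bond a c = true →
      ({a, b, c} : Finset (Fin 12)) ∈ tri)
    (link : ∀ v, ∀ A ⊆ tri.filter (fun S => v ∈ S), A.Nonempty →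
      (∀ S ∈ A, ∀ S' ∈ tri, v ∈ S' → (S ∩ S').card = 2 → S' ∈ A) → A = tri.filter fun S => v ∈ S)
    (two_bond_sides : ∀ S ∈ tri, ∃ a ∈ S, ∀ b ∈ S, b ≠ a → bond a b = true)
    (noOpenStar : ∀ v a₁ a₂ a₃ a₄ a₅ x : Fin 12, Function.Injective ![v, a₁, a₂, a₃, a₄, a₅, x] →
      bond v a₁ = true → bond v a₂ = true → bond v a₃ = true → bond v a₄ = true → bond v a₅ = true →
      bond a₁ a₂ = true → bond a₂ a₃ = true → bond a₃ a₄ = true → bond a₄ a₅ = true →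
      bond a₅ a₁ = false → bond x a₅ = true → bond x a₁ = true → bond v x = false → False)
    (v : Fin 12) (Sq : Finset (Fin 12)) (hP5 : (Finset.univ.filter fun w => bond v w = true).card = 5)
    (hSq : Sq ∈ tri) (hvSq : v ∈ Sq) (hC : ∀ w ∈ Sq, w ≠ v → bond v w = true)
    (hnF : ¬ ∀ p ∈ Sq, ∀ q ∈ Sq, p ≠ q → bond p q = true)
    (hE : ∀ S ∈ tri, v ∈ S → S ≠ Sq → ∀ p ∈ S, ∀ q ∈ S, p ≠ q → bond p q = true) : False := by
  have ne_of_bond : ∀ {p q : Fin 12}, bond p q = true → p ≠ q := fun h e => by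
    rw [e, bond_irrefl] at h
    exact Bool.false_ne_true h
  have hP4 : 4 ≤ (Finset.univ.filter fun w => bond v w = true).card := by rw [hP5]; norm_num
  obtain ⟨d, a, hSeq, hdv, hav, had, hvd, hva, hda⟩ := ffrK_qtri bond tri bond_symm tri_card hSq hvSq hC hnF
  obtain ⟨x, hdx, hxa, hvx, hxv⟩ := ffrK_qclose bond tri bond_symm bond_irrefl tri_card
    two_per_side bond_side bond_tri link two_bond_sides hP4 (hSeq ▸ hSq) hdv hav had hvd hva hda
  refine ffrK_star bond tri bond_symm bond_irrefl tri_card two_per_side bond_side bond_tri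
    noOpenStar (v := v) (a := d) (z := a) (x := x) {Sq} (Sa := Sq) (Sz := Sq) hP5 hvd hva
    had.symm hda (by rw [bond_symm]; exact hdx) hxa hvx hxv
    (fun S hS hvS hSQ => hE S hS hvS fun e => hSQ (e ▸ Finset.mem_singleton_self _)) hSq hvSq
    (hSeq ▸ by simp) ?_ (fun S hS _ => Finset.mem_singleton.1 hS) hSq hvSq (hSeq ▸ by simp) ?_ ?_
  · intro s hs hvs hds
    rw [hSeq] at hs
    simp only [Finset.mem_insert, Finset.mem_singleton] at hs
    rcases hs with e | e | e
    · exact (ne_of_bond hvs) e.symm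
    · exact (ne_of_bond hds) e.symm
    · rw [e, hda] at hds
      exact Bool.false_ne_true hds
  · intro s hs hvs has
    rw [hSeq] at hs
    simp only [Finset.mem_insert, Finset.mem_singleton] at hs
    rcases hs with e | e | e
    · exact (ne_of_bond hvs) e.symm
    · rw [e, bond_symm, hda] at has
      exact Bool.false_ne_true has
    · exact (ne_of_bond has) e.symm
  · intro S hS p hpS hvp
    rw [Finset.mem_singleton] at hS
    rw [hS, hSeq] at hpS
    simp only [Finset.mem_insert, Finset.mem_singleton] at hpS
    rcases hpS with e | e | e
    · exact absurd e (ne_of_bond hvp).symm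
    · exact Or.inl e
    · exact Or.inr e

/-- **`4T+H-pair` at a five-valent label is the open star.** If `v` has five bond partners, a
non-partner `x ≠ v` lies in a fan triangle at `v`, and every fan triangle at `v` not through `x`
is a bond triangle, then `noOpenStar` is violated. [folklore] -/
theorem ffrK_fourH (bond : Fin 12 → Fin 12 → Bool) (tri : Finset (Finset (Fin 12)))
    (bond_symm : ∀ v w, bond v w = bond w v) (bond_irrefl : ∀ v, bond v v = false)
    (tri_card : ∀ S ∈ tri, S.card = 3)
    (two_per_side : ∀ S ∈ tri, ∀ s ⊆ S, s.card = 2 → (tri.filter fun S' => s ⊆ S').card = 2)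
    (bond_side : ∀ v w, bond v w = true →
      (tri.filter fun S' => ({v, w} : Finset (Fin 12)) ⊆ S').card = 2)
    (bond_tri : ∀ a b c, a ≠ b → b ≠ c → a ≠ c → bond a b = true → bond b c = true → bond a c = true →
      ({a, b, c} : Finset (Fin 12)) ∈ tri)
    (link : ∀ v, ∀ A ⊆ tri.filter (fun S => v ∈ S), A.Nonempty →
      (∀ S ∈ A, ∀ S' ∈ tri, v ∈ S' → (S ∩ S').card = 2 → S' ∈ A) → A = tri.filter fun S => v ∈ S)
    (two_bond_sides : ∀ S ∈ tri, ∃ a ∈ S, ∀ b ∈ S, b ≠ a → bond a b = true)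
    (noOpenStar : ∀ v a₁ a₂ a₃ a₄ a₅ x : Fin 12, Function.Injective ![v, a₁, a₂, a₃, a₄, a₅, x] →
      bond v a₁ = true → bond v a₂ = true → bond v a₃ = true → bond v a₄ = true → bond v a₅ = true →
      bond a₁ a₂ = true → bond a₂ a₃ = true → bond a₃ a₄ = true → bond a₄ a₅ = true →
      bond a₅ a₁ = false → bond x a₅ = true → bond x a₁ = true → bond v x = false → False)
    {v x : Fin 12} (hP5 : (Finset.univ.filter fun w => bond v w = true).card = 5)
    (hxv : x ≠ v) (hvx : bond v x = false)
    {S₀ : Finset (Fin 12)} (hS₀ : S₀ ∈ tri) (hvS₀ : v ∈ S₀) (hxS₀ : x ∈ S₀)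
    (hE : ∀ S ∈ tri, v ∈ S → x ∉ S → ∀ p ∈ S, ∀ q ∈ S, p ≠ q → bond p q = true) : False := by
  have ne_of_bond : ∀ {p q : Fin 12}, bond p q = true → p ≠ q := fun h e => by
    rw [e, bond_irrefl] at h
    exact Bool.false_ne_true h
  have hP4 : 4 ≤ (Finset.univ.filter fun w => bond v w = true).card := by rw [hP5]; norm_num
  obtain ⟨a, z, heq, -, h1, h2, hav, hax, -, -, haz, hva, hax', hvz, hzx', hazb⟩ :=
    ffrK_hpair bond tri bond_symm bond_irrefl tri_card two_per_side bond_side bond_tri link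
      two_bond_sides hP4 hxv hvx hS₀ hvS₀ hxS₀
  -- the partners in a triangle through `x` are not `v`, not `x`
  have memx : ∀ (c p : Fin 12), p ∈ ({v, x, c} : Finset (Fin 12)) → bond v p = true → p = c := by
    intro c p hp hvp
    simp only [Finset.mem_insert, Finset.mem_singleton] at hp
    rcases hp with e | e | e
    · exact absurd e (ne_of_bond hvp).symm
    · rw [e, hvx] at hvp
      exact absurd hvp Bool.false_ne_true
    · exact e
  refine ffrK_star bond tri bond_symm bond_irrefl tri_card two_per_side bond_side bond_tri
    noOpenStar (v := v) (a := a) (z := z) (x := x) {{v, x, a}, {v, x, z}} (Sa := {v, x, a})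
    (Sz := {v, x, z}) hP5 hva hvz haz hazb (by rw [bond_symm]; exact hax')
    (by rw [bond_symm]; exact hzx') hvx hxv ?_ h1 (by simp) (by simp)
    (fun s hs hvs has => ne_of_bond has (memx a s hs hvs).symm) ?_ h2 (by simp) (by simp)
    (fun s hs hvs hzs => ne_of_bond hzs (memx z s hs hvs).symm) ?_
  · intro S hS hvS hSE
    refine hE S hS hvS fun hxS => hSE ?_
    rw [← heq]
    simp only [Finset.mem_filter]
    exact ⟨⟨hS, hvS⟩, hxS⟩
  · intro S hS haS
    simp only [Finset.mem_insert, Finset.mem_singleton] at hS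
    rcases hS with e | e
    · exact e
    · rw [e] at haS
      exact absurd (memx z a haS hva) haz
  · intro S hS p hpS hvp
    simp only [Finset.mem_insert, Finset.mem_singleton] at hS
    rcases hS with e | e <;> rw [e] at hpS
    · exact Or.inl (memx a p hpS hvp)
    · exact Or.inr (memx z p hpS hvp)

end Summit.AtomisticToContinuum.Crystallization.Theorems

end
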